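import Mathlib
import HarnessLib
import Literature.Analysis.FluidPDE.VorticityCalculus
import Summits.NavierStokesRegularity.NavierStokesRegularity.Theorems.HalfSpaceWindowDoorCirculationCarryingRigidityEddyTorqueOneSidedLiouville
import Summits.NavierStokesRegularity.NavierStokesRegularity.Theorems.HalfSpaceWindowDoorCirculationCarryingRigidityEddyTorqueStrata

/-!
# Route `HalfSpaceWindowDoor`, crux `CirculationCarryingRigidity` (stmt-NavierStokesRegularity-25311) — census theorem
# `eddy_torque` III: the closed-hemisphere sign slaves the ADVECTIVE eddy torque; only the eddy TILTING torque is free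

Line `eddy_torque` (LEAD ns-hsw-p1 g5).  The fluctuation remainder of AxisTwistDoor's circle-averaged swirl law splits as
`ℛ = ℛ_tilt − ℛ_adv`, `ℛ_tilt(r,z,s) = ∮_{S(r,z)} (v_z − v̄_z) ω_r dl` (eddy TILTING torque: correlation of the vertical-velocity
fluctuation with the radial vorticity on the axis circle) and `ℛ_adv = ∮ (v_r − v̄_r) ω₃ dl` (eddy ADVECTION of vertical vorticity).
OBSERVATION (`abs_remainder_sub_tilt_le`): under the closed-hemisphere sign `ω₃ ≥ 0` the advective part is AUTOMATICALLY slaved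
to the circle-integrated vertical vorticity, `|ℛ_adv| ≤ 2B·∮ω₃ dl` whenever `‖v‖ ≤ B` on the circle — so in the axis-Type-I class
`|ℛ_adv| ≤ 2D/(r+√(−s))·∮ω₃ dl` for free.  Feeding this into the one-sided eddy-torque Liouville theorem
(`…EddyTorqueOneSidedLiouville`, A ↦ A + 2D) gives the CENSUS THEOREM (`inner_curl_e3_eq_zero_of_axisTypeI_tiltTorque_le`):

  door class + axis-Type-I + `ω₃ ≥ 0` + ONE-SIDED TILTING bound `∮_{S(r,z)} (v_z − v̄_z) ω_r dl ≤ A/(r+√(−s))·∮_{S(r,z)} ω₃ dl` ⇒ POLOIDAL.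

CENSUS MEANING (25311).  The residue of the stub `HemisphereLiouvilleE3` in the axis-Type-I subclass is therefore exactly the
eddy TILTING spin-up: closed-hemisphere profiles for which, on some axis circles, vertical-velocity fluctuations correlate with
radial vorticity (`v'_z ω_r`) so as to spin the mean vortex UP faster than `a∮ω₃` — the 3D tilting mechanism (horizontal vorticity
tilted into the vertical by differential vertical motion) acting coherently around the circle.  Every other piece of the circle law
(mean advection, mean tilt `v̄_z∮ω_r`, eddy advection of `ω₃`) is harmless.

Seat ns-hsw-p1 g5 (LEAD of 25311, cell pub-ns-dss).  WHAT THIS IS NOT: not a statement about Navier–Stokes regularity (Clay A): a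
Liouville-type theorem about HYPOTHETICAL blow-up profiles; the crux, its stub and NS regularity remain OPEN; helper `--supports` 25311.
-/

noncomputable section

-- the summit and its single sub-problem share the name (CONVENTIONS §1), as in every Theorems file
set_option linter.dupNamespace false

namespace Summit.NavierStokesRegularity.NavierStokesRegularity.Theorems.HalfSpaceWindowDoorCirculationCarryingRigidityEddyTiltTorque

open MeasureTheory Set Function Filter Topology TopologicalSpace InnerProductSpace WithLp Metric
open scoped RealInnerProductSpace ContDiff
open Literature.Analysis Literature.Analysis.FluidPDE
open Summit.NavierStokesRegularity.NavierStokesRegularity.Theorems.AxisTwistDoorAveragedConeLiouvilleDefs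
  (cylPt eT e3 circ vortCirc radVortCirc meanR meanZ remainder SignE3)
open Summit.NavierStokesRegularity.NavierStokesRegularity.Theorems.AveragedConeLiouville.CircleStokes (continuous_eR)
open Summit.NavierStokesRegularity.NavierStokesRegularity.Theorems.AveragedConeLiouville.CircMonotone (vortCirc_nonneg)
open Summit.NavierStokesRegularity.NavierStokesRegularity.Theorems.AveragedConeLiouville.ShellBookkeeping (cylRadius_cylPt)
open Summit.NavierStokesRegularity.NavierStokesRegularity.Theorems.AxisTwistDoorAveragedConeLiouvilleCylFrame
  (continuous_cylPt_θ abs_inner_eR_le)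
open Summit.NavierStokesRegularity.NavierStokesRegularity.Theorems.HalfSpaceWindowDoorCirculationCarryingRigidityAxisCirculation
  (isSmoothSpaceTimeOn_of_class)
open Summit.NavierStokesRegularity.NavierStokesRegularity.Theorems.HalfSpaceWindowDoorCirculationCarryingRigidityAxisTypeILiouville
  (axisBound_nonneg axisBound_of_hasTypeIDecay)
open Summit.NavierStokesRegularity.NavierStokesRegularity.Theorems.HalfSpaceWindowDoorCirculationCarryingRigidityEddyTorqueOneSidedLiouville
  (inner_curl_e3_eq_zero_of_axisTypeI_remainder_le_oneSided)
open Summit.NavierStokesRegularity.NavierStokesRegularity.Theorems.HalfSpaceWindowDoorCirculationCarryingRigidityEddyTorqueStrata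
  (abs_meanR_le)

-- AxisTwistDoor's angular radial unit vector `e_r(θ)`, renamed to avoid the clash with the field `Literature.Analysis.FluidPDE.eR`
open Summit.NavierStokesRegularity.NavierStokesRegularity.Theorems.AxisTwistDoorAveragedConeLiouvilleDefs renaming eR → eRang

variable {C D A : ℝ} {v : ℝ → EuclideanSpace ℝ (Fin 3) → EuclideanSpace ℝ (Fin 3)}

/-! ### The advective eddy torque is slaved by the sign -/

/-- **THE SIGN SLAVES THE ADVECTIVE EDDY TORQUE.**  For a `C¹` slice with `ω₃ ≥ 0` and `‖v‖ ≤ B` on the axis circle `S(r,z)`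
(`r ≥ 0`): `|ℛ − ℛ_tilt| = |∮ (v_r − v̄_r) ω₃ dl| ≤ 2B · ∮ω₃ dl`, where `ℛ_tilt = ∮ (v_z − v̄_z) ω_r dl`. -/
theorem abs_remainder_sub_tilt_le {s r z B : ℝ} (hv : ContDiff ℝ 1 (v s)) (hsign : ∀ y, 0 ≤ ⟪curl (v s) y, e3⟫_ℝ)
    (hr : 0 ≤ r) (hB : ∀ θ : ℝ, ‖v s (cylPt r θ z)‖ ≤ B) :
    |remainder v r z s -
        ∫ θ in (0 : ℝ)..(2 * Real.pi), (⟪v s (cylPt r θ z), e3⟫_ℝ - meanZ v r z s) *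
          ⟪curl (v s) (cylPt r θ z), eRang θ⟫_ℝ * r| ≤ 2 * B * vortCirc v r z s := by
  have hB0 : 0 ≤ B := (norm_nonneg _).trans (hB 0)
  have hvc : Continuous fun θ => v s (cylPt r θ z) := hv.continuous.comp (continuous_cylPt_θ r z)
  have hωc : Continuous fun θ => curl (v s) (cylPt r θ z) := (continuous_curl hv).comp (continuous_cylPt_θ r z)
  -- the two integrands
  have hTc : Continuous fun θ => (⟪v s (cylPt r θ z), e3⟫_ℝ - meanZ v r z s) * ⟪curl (v s) (cylPt r θ z), eRang θ⟫_ℝ * r :=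
    (((hvc.inner continuous_const).sub continuous_const).mul (hωc.inner continuous_eR)).mul continuous_const
  have hAc : Continuous fun θ => (⟪v s (cylPt r θ z), eRang θ⟫_ℝ - meanR v r z s) * ⟪curl (v s) (cylPt r θ z), e3⟫_ℝ * r :=
    (((hvc.inner continuous_eR).sub continuous_const).mul (hωc.inner continuous_const)).mul continuous_const
  have hsplit : remainder v r z s =
      (∫ θ in (0 : ℝ)..(2 * Real.pi), (⟪v s (cylPt r θ z), e3⟫_ℝ - meanZ v r z s) * ⟪curl (v s) (cylPt r θ z), eRang θ⟫_ℝ * r) -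
        ∫ θ in (0 : ℝ)..(2 * Real.pi), (⟪v s (cylPt r θ z), eRang θ⟫_ℝ - meanR v r z s) *
          ⟪curl (v s) (cylPt r θ z), e3⟫_ℝ * r := by
    rw [← intervalIntegral.integral_sub (hTc.intervalIntegrable _ _) (hAc.intervalIntegrable _ _)]
    simp only [remainder]
    refine intervalIntegral.integral_congr fun θ _ => ?_
    ring
  rw [hsplit, sub_sub_cancel_left, abs_neg]
  -- `|∫ (v_r − v̄_r) ω₃ r| ≤ ∫ 2B ω₃ r = 2B ∮ω₃`
  have hmR := abs_meanR_le (v := v) (s := s) (r := r) (z := z) hB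
  have hpt : ∀ θ, |(⟪v s (cylPt r θ z), eRang θ⟫_ℝ - meanR v r z s) * ⟪curl (v s) (cylPt r θ z), e3⟫_ℝ * r| ≤
      2 * B * (⟪curl (v s) (cylPt r θ z), e3⟫_ℝ * r) := by
    intro θ
    have h1 : |⟪v s (cylPt r θ z), eRang θ⟫_ℝ - meanR v r z s| ≤ 2 * B := by
      have := abs_inner_eR_le (v s (cylPt r θ z)) θ
      have h := abs_sub (⟪v s (cylPt r θ z), eRang θ⟫_ℝ) (meanR v r z s)
      linarith [hB θ]
    have h2 : 0 ≤ ⟪curl (v s) (cylPt r θ z), e3⟫_ℝ * r := mul_nonneg (hsign _) hr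
    rw [mul_assoc, abs_mul, abs_of_nonneg h2]
    exact mul_le_mul_of_nonneg_right h1 h2
  have hgc : Continuous fun θ => 2 * B * (⟪curl (v s) (cylPt r θ z), e3⟫_ℝ * r) :=
    continuous_const.mul ((hωc.inner continuous_const).mul continuous_const)
  have hle := intervalIntegral.norm_integral_le_of_norm_le (μ := volume) (a := 0) (b := 2 * Real.pi)
    (f := fun θ => (⟪v s (cylPt r θ z), eRang θ⟫_ℝ - meanR v r z s) * ⟪curl (v s) (cylPt r θ z), e3⟫_ℝ * r)
    (g := fun θ => 2 * B * (⟪curl (v s) (cylPt r θ z), e3⟫_ℝ * r)) (by positivity)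
    (Eventually.of_forall fun θ _ => by rw [Real.norm_eq_abs]; exact hpt θ) (hgc.intervalIntegrable _ _)
  rw [Real.norm_eq_abs] at hle
  refine hle.trans (le_of_eq ?_)
  rw [intervalIntegral.integral_const_mul]
  rfl

/-! ### The census theorem with the tilting hypothesis only -/

/-- **THE EDDY-TILTING CENSUS THEOREM.**  A profile of the door's Type-I ancient Oseen-mild class with the AXIS-Type-I bound
`‖v(t,x)‖ ≤ D/(|x_h| + √(−t))`, the closed-hemisphere sign `⟪curl v, e₃⟫ ≥ 0`, and the ONE-SIDED bound on the eddy TILTING torque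
alone, `∮_{S(r,z)} (v_z − v̄_z) ω_r dl ≤ A/(r + √(−s)) · ∮_{S(r,z)} ω₃ dl` for all `r > 0`, `z`, `s < 0`, is POLOIDAL: `⟪curl v, e₃⟫ ≡ 0`
on the slab.  (The advective eddy torque is slaved by the sign, `abs_remainder_sub_tilt_le` with `B = D/(r+√(−s))`; then the
one-sided eddy-torque Liouville theorem with the constant `A + 2D`.) -/
theorem inner_curl_e3_eq_zero_of_axisTypeI_tiltTorque_le (C D A : ℝ)
    (v : ℝ → EuclideanSpace ℝ (Fin 3) → EuclideanSpace ℝ (Fin 3))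
    (hrate : HasTypeITimeDecay C v)
    (hcont : ContinuousOn (uncurry v) (Iio (0 : ℝ) ×ˢ univ))
    (hmild : ∀ s t : ℝ, s < t → t < 0 → ∀ x,
      v t x = UnboundedOperators.heatExtension (v s) (t - s) x - oseenDuhamel 1 s v v t x)
    (hdiv : ∀ t < 0, VectorCalculus.IsDivFree (v t))
    (hDax : ∀ t < 0, ∀ x : EuclideanSpace ℝ (Fin 3), ‖v t x‖ ≤ D / (cylRadius x + Real.sqrt (-t)))
    (hsign : ∀ s < 0, ∀ y, 0 ≤ ⟪curl (v s) y, (EuclideanSpace.single (2 : Fin 3) (1 : ℝ))⟫_ℝ)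
    (hA : 0 ≤ A)
    (htilt : ∀ s < 0, ∀ r : ℝ, 0 < r → ∀ z : ℝ,
      (∫ θ in (0 : ℝ)..(2 * Real.pi), (⟪v s (cylPt r θ z), e3⟫_ℝ - meanZ v r z s) *
          ⟪curl (v s) (cylPt r θ z), eRang θ⟫_ℝ * r) ≤ A / (r + Real.sqrt (-s)) * vortCirc v r z s) :
    ∀ s < 0, ∀ y, ⟪curl (v s) y, (EuclideanSpace.single (2 : Fin 3) (1 : ℝ))⟫_ℝ = 0 := by
  have hsm : IsSmoothSpaceTimeOn (Iio (0 : ℝ)) v := isSmoothSpaceTimeOn_of_class hrate hcont hmild hdiv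
  have hD : 0 ≤ D := axisBound_nonneg hDax
  refine inner_curl_e3_eq_zero_of_axisTypeI_remainder_le_oneSided C D (A + 2 * D) v hrate hcont hmild hdiv hDax hsign
    (by positivity) fun s hs r hr z => ?_
  have hv1 : ContDiff ℝ 1 (v s) := (hsm.contDiff_slice hs).of_le (by norm_cast)
  have hsq : 0 < Real.sqrt (-s) := Real.sqrt_pos.2 (by linarith)
  have hB : ∀ θ : ℝ, ‖v s (cylPt r θ z)‖ ≤ D / (r + Real.sqrt (-s)) := by
    intro θ
    have h := hDax s hs (cylPt r θ z)
    rwa [cylRadius_cylPt hr.le] at h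
  have hsign' : ∀ y, 0 ≤ ⟪curl (v s) y, e3⟫_ℝ := hsign s hs
  have h1 := abs_remainder_sub_tilt_le (v := v) (z := z) hv1 hsign' hr.le hB
  have h2 := htilt s hs r hr z
  have h3 := (abs_le.1 h1).2
  have e : (A + 2 * D) / (r + Real.sqrt (-s)) * vortCirc v r z s =
      A / (r + Real.sqrt (-s)) * vortCirc v r z s + 2 * (D / (r + Real.sqrt (-s))) * vortCirc v r z s := by ring
  rw [e]
  linarith

/-- **Corollary (space–time Type-I subclass).** -/
theorem inner_curl_e3_eq_zero_of_hasTypeIDecay_tiltTorque_le (C D A : ℝ)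
    (v : ℝ → EuclideanSpace ℝ (Fin 3) → EuclideanSpace ℝ (Fin 3))
    (hrate : HasTypeITimeDecay C v)
    (hcont : ContinuousOn (uncurry v) (Iio (0 : ℝ) ×ˢ univ))
    (hmild : ∀ s t : ℝ, s < t → t < 0 → ∀ x,
      v t x = UnboundedOperators.heatExtension (v s) (t - s) x - oseenDuhamel 1 s v v t x)
    (hdiv : ∀ t < 0, VectorCalculus.IsDivFree (v t)) (hDec : HasTypeIDecay D v)
    (hsign : ∀ s < 0, ∀ y, 0 ≤ ⟪curl (v s) y, (EuclideanSpace.single (2 : Fin 3) (1 : ℝ))⟫_ℝ)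
    (hA : 0 ≤ A)
    (htilt : ∀ s < 0, ∀ r : ℝ, 0 < r → ∀ z : ℝ,
      (∫ θ in (0 : ℝ)..(2 * Real.pi), (⟪v s (cylPt r θ z), e3⟫_ℝ - meanZ v r z s) *
          ⟪curl (v s) (cylPt r θ z), eRang θ⟫_ℝ * r) ≤ A / (r + Real.sqrt (-s)) * vortCirc v r z s) :
    ∀ s < 0, ∀ y, ⟪curl (v s) y, (EuclideanSpace.single (2 : Fin 3) (1 : ℝ))⟫_ℝ = 0 :=
  inner_curl_e3_eq_zero_of_axisTypeI_tiltTorque_le C D A v hrate hcont hmild hdiv (axisBound_of_hasTypeIDecay hDec)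
    hsign hA htilt

/-- **Corollary (no eddy tilting spin-up ⇒ poloidal).**  If on every axis circle the vertical-velocity fluctuation and the radial
vorticity are non-positively correlated, `∮ (v_z − v̄_z) ω_r dl ≤ 0`, a closed-hemisphere axis-Type-I profile is poloidal. -/
theorem inner_curl_e3_eq_zero_of_axisTypeI_tiltTorque_nonpos (C D : ℝ)
    (v : ℝ → EuclideanSpace ℝ (Fin 3) → EuclideanSpace ℝ (Fin 3))
    (hrate : HasTypeITimeDecay C v)
    (hcont : ContinuousOn (uncurry v) (Iio (0 : ℝ) ×ˢ univ))
    (hmild : ∀ s t : ℝ, s < t → t < 0 → ∀ x,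
      v t x = UnboundedOperators.heatExtension (v s) (t - s) x - oseenDuhamel 1 s v v t x)
    (hdiv : ∀ t < 0, VectorCalculus.IsDivFree (v t))
    (hDax : ∀ t < 0, ∀ x : EuclideanSpace ℝ (Fin 3), ‖v t x‖ ≤ D / (cylRadius x + Real.sqrt (-t)))
    (hsign : ∀ s < 0, ∀ y, 0 ≤ ⟪curl (v s) y, (EuclideanSpace.single (2 : Fin 3) (1 : ℝ))⟫_ℝ)
    (htilt : ∀ s < 0, ∀ r : ℝ, 0 < r → ∀ z : ℝ,
      (∫ θ in (0 : ℝ)..(2 * Real.pi), (⟪v s (cylPt r θ z), e3⟫_ℝ - meanZ v r z s) *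
          ⟪curl (v s) (cylPt r θ z), eRang θ⟫_ℝ * r) ≤ 0) :
    ∀ s < 0, ∀ y, ⟪curl (v s) y, (EuclideanSpace.single (2 : Fin 3) (1 : ℝ))⟫_ℝ = 0 :=
  inner_curl_e3_eq_zero_of_axisTypeI_tiltTorque_le C D 0 v hrate hcont hmild hdiv hDax hsign le_rfl
    fun s hs r hr z => (htilt s hs r hr z).trans (by
      rw [zero_div, zero_mul])

/-! ### The tilting torque is a vertical-shear correlation (appended, LEAD ns-hsw-p1 g5) -/

section ShearCorrelation

open Summit.NavierStokesRegularity.NavierStokesRegularity.Theorems.AveragedConeLiouville.CircleStokes (continuous_eT inner_e3 cylPt_two_pi)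
open Summit.NavierStokesRegularity.NavierStokesRegularity.Theorems.AxisTwistDoorAveragedConeLiouvilleCylFrame
  (hasDerivAt_slice_comp_cylPt_θ inner_curl_eR_mul)
open Summit.NavierStokesRegularity.NavierStokesRegularity.Theorems.HalfSpaceWindowDoorCirculationCarryingRigidityEddyTorqueStrata
  (integral_sub_const_mul_deriv_eq_zero)

/-- **THE TILTING TORQUE IS A VERTICAL-SHEAR CORRELATION.**  On the axis circle `S(r,z)`, `ω_r r = ∂_θ v_z − r ∂_z v_θ` and
`∮ (v_z − v̄_z) ∂_θ v_z dθ = 0` by periodicity, so for a `C¹` slice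
`∮ (v_z − v̄_z) ω_r dl = −r ∫₀^{2π} (v_z − v̄_z) ⟪∂_z v, e_θ⟫ dθ`: the eddy tilting torque is minus `r` times the correlation, around
the circle, of the vertical-velocity fluctuation with the vertical shear of the azimuthal velocity. -/
theorem tilt_eq_neg_shearCorrelation {s : ℝ} (hv : ContDiff ℝ 1 (v s)) (r z : ℝ) :
    (∫ θ in (0 : ℝ)..(2 * Real.pi), (⟪v s (cylPt r θ z), e3⟫_ℝ - meanZ v r z s) *
        ⟪curl (v s) (cylPt r θ z), eRang θ⟫_ℝ * r) =
      -(r * ∫ θ in (0 : ℝ)..(2 * Real.pi), (⟪v s (cylPt r θ z), e3⟫_ℝ - meanZ v r z s) *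
        ⟪fderiv ℝ (v s) (cylPt r θ z) e3, eT θ⟫_ℝ) := by
  have hd : Differentiable ℝ (v s) := hv.differentiable one_ne_zero
  set a : ℝ → ℝ := fun θ => ⟪v s (cylPt r θ z), e3⟫_ℝ with ha
  set a' : ℝ → ℝ := fun θ => fderiv ℝ (v s) (cylPt r θ z) (r • eT θ) 2 with ha'
  set Z : ℝ := meanZ v r z s with hZ
  have haD : ∀ θ, HasDerivAt a (a' θ) θ := by
    intro θ
    have h := (hasDerivAt_slice_comp_cylPt_θ hd r θ z).inner ℝ (hasDerivAt_const θ e3)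
    simpa [ha, ha', inner_e3] using h
  have hp := continuous_cylPt_θ r z
  have huc : Continuous fun θ => v s (cylPt r θ z) := hv.continuous.comp hp
  have hDc : Continuous fun θ => fderiv ℝ (v s) (cylPt r θ z) := (hv.continuous_fderiv one_ne_zero).comp hp
  have hac : Continuous a := huc.inner continuous_const
  have ha'c : Continuous a' :=
    (EuclideanSpace.proj (2 : Fin 3) : EuclideanSpace ℝ (Fin 3) →L[ℝ] ℝ).continuous.comp
      (hDc.clm_apply (continuous_eT.const_smul r))
  have hshc : Continuous fun θ => ⟪fderiv ℝ (v s) (cylPt r θ z) e3, eT θ⟫_ℝ := (hDc.clm_apply continuous_const).inner continuous_eT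
  -- pointwise: `(a − Z) ω_r r = (a − Z) a' − r (a − Z) ⟪Dv e₃, e_θ⟫`
  have hpt : ∀ θ, (⟪v s (cylPt r θ z), e3⟫_ℝ - Z) * ⟪curl (v s) (cylPt r θ z), eRang θ⟫_ℝ * r =
      (a θ - Z) * a' θ - r * ((a θ - Z) * ⟪fderiv ℝ (v s) (cylPt r θ z) e3, eT θ⟫_ℝ) := by
    intro θ
    rw [mul_assoc, inner_curl_eR_mul (v s) r θ z]
    simp only [ha, ha']
    ring
  have hI1 : ∫ θ in (0 : ℝ)..(2 * Real.pi), (a θ - Z) * a' θ = 0 :=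
    integral_sub_const_mul_deriv_eq_zero haD ha'c (by simp only [ha, cylPt_two_pi]) Z
  have i1 : IntervalIntegrable (fun θ => (a θ - Z) * a' θ) MeasureTheory.volume 0 (2 * Real.pi) :=
    ((hac.sub continuous_const).mul ha'c).intervalIntegrable _ _
  have i2 : IntervalIntegrable (fun θ => r * ((a θ - Z) * ⟪fderiv ℝ (v s) (cylPt r θ z) e3, eT θ⟫_ℝ))
      MeasureTheory.volume 0 (2 * Real.pi) :=
    (continuous_const.mul ((hac.sub continuous_const).mul hshc)).intervalIntegrable _ _
  rw [intervalIntegral.integral_congr (fun θ _ => hpt θ), intervalIntegral.integral_sub i1 i2, hI1,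
    intervalIntegral.integral_const_mul, zero_sub]

/-- **THE VERTICAL-SHEAR CENSUS THEOREM.**  A profile of the door's Type-I ancient Oseen-mild class with the AXIS-Type-I bound, the
closed-hemisphere sign `⟪curl v, e₃⟫ ≥ 0`, and the one-sided bound on the vertical-shear correlation
`−r ∫₀^{2π} (v_z − v̄_z) ⟪∂_z v, e_θ⟫ dθ ≤ A/(r + √(−s)) · ∮_{S(r,z)} ω₃ dl` for all `r > 0`, `z`, `s < 0`, is POLOIDAL.  RESIDUE of the
stub in the axis-Type-I subclass: closed-hemisphere profiles in which, on some axis circles, DOWNdraughts (`v_z < v̄_z`) sit where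
the azimuthal velocity increases with height and updraughts where it decreases, coherently enough to beat `a∮ω₃`. -/
theorem inner_curl_e3_eq_zero_of_axisTypeI_shearCorrelation_le (C D A : ℝ)
    (v : ℝ → EuclideanSpace ℝ (Fin 3) → EuclideanSpace ℝ (Fin 3))
    (hrate : HasTypeITimeDecay C v)
    (hcont : ContinuousOn (uncurry v) (Iio (0 : ℝ) ×ˢ univ))
    (hmild : ∀ s t : ℝ, s < t → t < 0 → ∀ x,
      v t x = UnboundedOperators.heatExtension (v s) (t - s) x - oseenDuhamel 1 s v v t x)
    (hdiv : ∀ t < 0, VectorCalculus.IsDivFree (v t))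
    (hDax : ∀ t < 0, ∀ x : EuclideanSpace ℝ (Fin 3), ‖v t x‖ ≤ D / (cylRadius x + Real.sqrt (-t)))
    (hsign : ∀ s < 0, ∀ y, 0 ≤ ⟪curl (v s) y, (EuclideanSpace.single (2 : Fin 3) (1 : ℝ))⟫_ℝ)
    (hA : 0 ≤ A)
    (hshear : ∀ s < 0, ∀ r : ℝ, 0 < r → ∀ z : ℝ,
      -(r * ∫ θ in (0 : ℝ)..(2 * Real.pi), (⟪v s (cylPt r θ z), e3⟫_ℝ - meanZ v r z s) *
          ⟪fderiv ℝ (v s) (cylPt r θ z) e3, eT θ⟫_ℝ) ≤ A / (r + Real.sqrt (-s)) * vortCirc v r z s) :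
    ∀ s < 0, ∀ y, ⟪curl (v s) y, (EuclideanSpace.single (2 : Fin 3) (1 : ℝ))⟫_ℝ = 0 := by
  have hsm : IsSmoothSpaceTimeOn (Iio (0 : ℝ)) v := isSmoothSpaceTimeOn_of_class hrate hcont hmild hdiv
  refine inner_curl_e3_eq_zero_of_axisTypeI_tiltTorque_le C D A v hrate hcont hmild hdiv hDax hsign hA fun s hs r hr z => ?_
  have hv1 : ContDiff ℝ 1 (v s) := (hsm.contDiff_slice hs).of_le (by norm_cast)
  rw [tilt_eq_neg_shearCorrelation (v := v) hv1 r z]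
  exact hshear s hs r hr z

end ShearCorrelation

end Summit.NavierStokesRegularity.NavierStokesRegularity.Theorems.HalfSpaceWindowDoorCirculationCarryingRigidityEddyTiltTorque

end
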